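import Summits.Ventures.CertifiedQuantumChemistry.Rows.HoleTransferTable
import HarnessLib

/-!
# Ventures/CertifiedQuantumChemistry — Rows/ParticleTransferTable.lean: the PARTICLE-TRANSFER TABLE
# FILE `K = μ·F + t·𝔾ᵖ_c − 𝕏ᵖ_c` of a `dE-direct:s` (vertical electron-ATTACHMENT) certificate as an
# exact-rational `Model k` and its symmetries (the tool's table, `particleTwoBody_eq_sym8`; 8-fold rule inherited)

HONEST FRAMING (verbatim): certified bounds for a stated model Hamiltonian in a stated basis; not a
claim about the real molecule or material beyond that model. `K` is NOT a physical Hamiltonian; it is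
DATA for one SDP leg.

Typer chem-type-09 (LADDER-CHEM I-TYPE slot 09 class (s), item (L2) of chem-solver-5's
`solver/diff-sector/DESIGN.md` §2.2/§4.1/§6, class `particle`; order per chem-solver-5
2026-08-27T00:16:47Z «hole/particle tables FIRST … red = particle (12,12)→(13,12)»). Companion of
`Rows/HoleTransferTable.lean` (same vocabulary: `holeOp c σ = a_{cσ}`, so the particle transfer is its
adjoint `a†_{cσ} = (holeOp c σ)ᴴ`). The object typed is the table written by the cell's exact tool
`solver/diff-sector/tools/fcidump_transfer.py` 0.1.0, class `particle`, for a pinned file `F`, a rational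
orbital vector `c`, rationals `μ ≥ 0`, `t`:
* core constant `μ·E_core + 2t·|c|² − 2Σ_mn c_m h_nm c_n`;
* one-body `μ·h_pq − t·c_p c_q − ½(M_pq + M_qp)` with
  `M_xy = −c_y (ch)_x + 2Σ_mn c_m c_n g_{n m y x} − Σ_mn c_m c_n g_{n x m y}`, `(ch)_x = Σ_n c_n h_nx`;
* two-body `μ·g_pqrs + (B_pqrs + B_qpsr + B_rspq + B_srqp)/2` with `B_pqrs = c_q Σ_n c_n g_{n p s r}`
  (equal to the tool's `−2·sym8(A2)`, `A2 = −B`, under `(pq|rs) = (pq|sr)`: `particleTwoBody_eq_sym8`).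

## Contents
* §1 `Model.particleTable c t F` (the `t·𝔾ᵖ − 𝕏ᵖ` part) and `Model.transferParticle c μ t F :=
  Model.lincomb μ 1 F (particleTable c t F)` (the file `K`); `particleTable_isSymmetric`,
  `transferParticle_isSymmetric`, `particleTwoBody_swap`, `particleTwoBody_eq_sym8`,
  `transferParticle_isEightfold`.
* The operators (`particleGram`, `particleCommutatorOp` with the NORMAL-ORDERED particle twin of HJO
  (10.8.20)) are `Rows/ParticleTransferOperators.lean`; the operator identity
  `Ĥ(K) = μ·Ĥ(F) + t·Gᵖ_c − ½(Oᵖ + Oᵖᴴ)` and the END-TO-END attachment rows are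
  `Rows/ParticleTransferRows.lean` (split for size).

What is NOT here: the spin-flip class; any certificate instance, number or claim node. Printed
neighbours (ESTIMATORS in print, never certificates): extended Koopmans electron affinities; HJO
§10.8.3. [cite: HelgakerJorgensenOlsen2000, eq. (10.8.20)]
-/

noncomputable section

namespace Summit.Ventures.CertifiedQuantumChemistry

open Matrix Finset
open Literature.MathematicalPhysics.QuantumLattice Literature.MathematicalPhysics.QuantumChemistry
open Literature.MathematicalPhysics.QuantumLattice.EigenvalueContinuation
open scoped ComplexOrder

variable {k : ℕ}

/-! ## §1 The exact-rational tables -/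

namespace Model

/-- The constant `2Σ_mn c_m h_nm c_n` of the normal-ordered particle commutator. -/
def particleConst (c : Fin k → ℚ) (F : Model k) : ℚ := 2 * ∑ m : Fin k, ∑ n : Fin k, c m * F.h n m * c n

/-- The raw one-body coefficient matrix `M_xy` (coefficient of `E_xy` in `Σ_mn c_m c_n Σ_σ a_{mσ}[Ĥ, a†_{nσ}]`):
`−c_y (ch)_x + 2Σ_mn c_m c_n g_{n m y x} − Σ_mn c_m c_n g_{n x m y}`. -/
def particleOneBodyRaw (c : Fin k → ℚ) (F : Model k) (x y : Fin k) : ℚ :=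
  -(c y * holeVecH c F x) + 2 * (∑ m : Fin k, ∑ n : Fin k, c m * c n * F.eri n m y x) -
    ∑ m : Fin k, ∑ n : Fin k, c m * c n * F.eri n x m y

/-- The raw two-body coefficient `B_pqrs = c_q · Σ_n c_n g_{n p s r}` (MINUS the coefficient of `e_pqrs`
in the normal-ordered commutator). -/
def particleTwoBodyRaw (c : Fin k → ℚ) (F : Model k) (p q r s : Fin k) : ℚ :=
  c q * ∑ n : Fin k, c n * F.eri n p s r

/-- The symmetrised two-body table `(B_pqrs + B_qpsr + B_rspq + B_srqp)/2`. -/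
def particleTwoBody (c : Fin k → ℚ) (F : Model k) (p q r s : Fin k) : ℚ :=
  (particleTwoBodyRaw c F p q r s + particleTwoBodyRaw c F q p s r + particleTwoBodyRaw c F r s p q +
    particleTwoBodyRaw c F s r q p) / 2

/-- **The particle table** `t·𝔾ᵖ_c − 𝕏ᵖ_c` (chem-solver-5 DESIGN §4.1; `fcidump_transfer.py` class
`particle` without the `μ·F` part): core constant `2t|c|² − particleConst`, one-body
`−t·c_p c_q − ½(M_pq + M_qp)`, two-body `particleTwoBody`. [cite: HelgakerJorgensenOlsen2000, eq. (10.8.20)] -/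
def particleTable (c : Fin k → ℚ) (t : ℚ) (F : Model k) : Model k where
  h p q := -(t * (c p * c q)) - (particleOneBodyRaw c F p q + particleOneBodyRaw c F q p) / 2
  eri := particleTwoBody c F
  ecore := 2 * t * (∑ q : Fin k, c q * c q) - particleConst c F

/-- **THE PARTICLE-TRANSFER TABLE FILE `K = μ·F + t·𝔾ᵖ_c − 𝕏ᵖ_c`** =
`Model.lincomb μ 1 F (particleTable c t F)`. [cite: HelgakerJorgensenOlsen2000, eq. (10.8.20)] -/
def transferParticle (c : Fin k → ℚ) (μ t : ℚ) (F : Model k) : Model k :=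
  Model.lincomb μ 1 F (particleTable c t F)

/-- The particle table is symmetric (`Model.IsSymmetric`) by construction, for ANY `F`. -/
theorem particleTable_isSymmetric (c : Fin k → ℚ) (t : ℚ) (F : Model k) :
    (particleTable c t F).IsSymmetric := by
  refine ⟨fun p q => ?_, fun p q r s => ?_⟩
  · simp only [particleTable]; ring
  · simp only [particleTable, particleTwoBody]; ring

/-- `K` is symmetric when `F` is. -/
theorem transferParticle_isSymmetric {F : Model k} (hF : F.IsSymmetric) (c : Fin k → ℚ) (μ t : ℚ) :
    (transferParticle c μ t F).IsSymmetric :=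
  Model.lincomb_isSymmetric hF (particleTable_isSymmetric c t F)

/-- Tables of `K` (by definition): one-body. -/
theorem transferParticle_h (c : Fin k → ℚ) (μ t : ℚ) (F : Model k) (p q : Fin k) :
    (transferParticle c μ t F).h p q = μ * F.h p q +
      (-(t * (c p * c q)) - (particleOneBodyRaw c F p q + particleOneBodyRaw c F q p) / 2) := by
  simp [transferParticle, Model.lincomb, particleTable]

/-- Tables of `K` (by definition): two-body. -/
theorem transferParticle_eri (c : Fin k → ℚ) (μ t : ℚ) (F : Model k) (p q r s : Fin k) :
    (transferParticle c μ t F).eri p q r s = μ * F.eri p q r s + particleTwoBody c F p q r s := by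
  simp [transferParticle, Model.lincomb, particleTable]

/-- Tables of `K` (by definition): core constant. -/
theorem transferParticle_ecore (c : Fin k → ℚ) (μ t : ℚ) (F : Model k) :
    (transferParticle c μ t F).ecore =
      μ * F.ecore + (2 * t * (∑ q : Fin k, c q * c q) - particleConst c F) := by
  simp [transferParticle, Model.lincomb, particleTable]

/-- With `(pq|rs) = (pq|sr)` the symmetrised particle two-body table is invariant under exchanging its
first two indices (hence equals the tool's 8-term symmetrisation, `particleTwoBody_eq_sym8`). -/
theorem particleTwoBody_swap {F : Model k} (hF : ∀ p q r s, F.eri p q r s = F.eri p q s r)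
    (c : Fin k → ℚ) (p q r s : Fin k) : particleTwoBody c F q p r s = particleTwoBody c F p q r s := by
  have hcg : ∀ m x y z : Fin k, particleTwoBodyRaw c F x m y z = particleTwoBodyRaw c F x m z y := by
    intro m x y z
    simp only [particleTwoBodyRaw]
    congr 1
    exact Finset.sum_congr rfl fun n _ => by rw [hF n x z y]
  simp only [particleTwoBody]
  rw [hcg p q r s, hcg q p s r, hcg s r q p, hcg r s p q]
  ring

/-- **The typed table IS the tool's table**: for `(pq|rs) = (pq|sr)`, `particleTwoBody` is the 8-term
average `(Σ over the 8 FCIDUMP index images of B)/4 = 2·sym8(B)` (`fcidump_transfer.py` 0.1.0 writes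
`gK = μ·g − 2·sym8(A2)` with `A2 = −B`). -/
theorem particleTwoBody_eq_sym8 {F : Model k} (hF : ∀ p q r s, F.eri p q r s = F.eri p q s r)
    (c : Fin k → ℚ) (p q r s : Fin k) :
    particleTwoBody c F p q r s =
      (particleTwoBodyRaw c F p q r s + particleTwoBodyRaw c F q p r s + particleTwoBodyRaw c F p q s r +
        particleTwoBodyRaw c F q p s r + particleTwoBodyRaw c F r s p q + particleTwoBodyRaw c F s r p q +
        particleTwoBodyRaw c F r s q p + particleTwoBodyRaw c F s r q p) / 4 := by
  have h := particleTwoBody_swap hF c p q r s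
  simp only [particleTwoBody] at h ⊢
  linarith

/-- **`K` inherits the full 8-fold rule** from `F` (a legal `.clean` FCIDUMP model). -/
theorem transferParticle_isEightfold {F : Model k} (hF : F.IsEightfold) (c : Fin k → ℚ) (μ t : ℚ) :
    (transferParticle c μ t F).IsEightfold := by
  refine ⟨fun p q => ?_, fun p q r s => ?_, fun p q r s => ?_, fun p q r s => ?_⟩
  · rw [transferParticle_h, transferParticle_h, hF.1 p q]; ring
  · rw [transferParticle_eri, transferParticle_eri, hF.2.1 p q r s,
      particleTwoBody_swap hF.2.2.1 c q p r s]
  · rw [transferParticle_eri, transferParticle_eri, hF.2.2.1 p q r s]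
    have h1 := particleTwoBody_swap hF.2.2.1 c s r q p
    have h2 : particleTwoBody c F p q s r = particleTwoBody c F r s q p := by
      simp only [particleTwoBody]; ring
    have h3 : particleTwoBody c F p q r s = particleTwoBody c F s r q p := by
      simp only [particleTwoBody]; ring
    rw [h2, h3, h1]
  · rw [transferParticle_eri, transferParticle_eri, hF.2.2.2 p q r s]
    simp only [particleTwoBody]; ring

end Model

end Summit.Ventures.CertifiedQuantumChemistry

end
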